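import Summits.HodgeConjecture.HodgeConjecture.Theorems.VHCAbelianSchemesRoadPsiStableCoreFinite
import HarnessLib

/-!
# Road №4 (`VHCAbelianSchemesRoad`) — `ψ̄` ON THE SECANT QUOTIENT: the descent of `φ_d` to `Y = (J × Ĵ)/Ḡ`, movers are
# `m + ψ̄`, and the order of a point of a mover kernel divides `m² + d`

research route conditional on HC_CM; not a corollary; Q11.4-sentence-2 already refuted in dim ≥ 3.

PROOFS ONLY (core-w1 gen 2, width copy of seat core-D; piece P2 of core-w5 g3's S2 (L-A)∕(L-B) CUT, ring2 INBOX
2026-08-28T20:39Z; helper `--supports stmt-HodgeConjecture-26512`; `HC_CM` nowhere; ZERO named facts; nothing about any cell,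
stub, crux, carrier, `HC_AV` or HC is asserted). For a secant–quotient datum `D` (`P = J × Ĵ`, `φ_d = D.ψ` with
`φ_d² = −d`, the quotient isogeny `q : P → Y`):

* `exists_psiBar` — **`φ_d` DESCENDS to `Y`**: some `ψ̄ : Y → Y` with `q ≫ ψ̄ = φ_d ≫ q` (the mover of `u = 0 + φ_d`,
  `SecantQuotientDatum.hasMover D 0`; Markman §1.5 ∕ Lemma 9.3.3: `φ_d(Ḡ) = Ḡ`);
* (`ψ̄ ≫ ψ̄ = −d` is core-w5 g3's `psiBar_comp_psiBar'` of `…PsiStableCoreFinite`, imported, not restated);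
* `IsMover.eq_zsmul_id_add_psiBar` — **every mover is `ḡ_u = m + ψ̄`** (`u = m + φ_d`; uniqueness of descent along `q`);
* `IsMover.pointsMap_psiBar_eq` — on a complex point `x` of `Ker ḡ_u`, `ψ̄(x) = x^{−m}`;
* `IsMover.zpow_sq_add_eq_one` — **`x^{m² + d} = 1` for `x ∈ Ker ḡ_u(ℂ)`** (`x^{m²} = ψ̄(ψ̄(x)) = x^{−d}`), whence
  `IsMover.isOfFinOrder_of_mem_kerPoints` and `IsMover.orderOf_dvd_of_mem_kerPoints` (`ord x ∣ m² + d`).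

These are the inputs of the (L-B) assembly `moverConfinement_of_KSimple` (S2 of line N) and of the (L-A) core
(`ψ̄`-stable finite cores). Mathlib: `orderOf_dvd_iff_zpow_eq_one`, `isOfFinOrder_iff_zpow_eq_one`; tree: `hasMover`, `IsMover.q_comp`,
`isIsogeny_q`, `IsIsogeny.cancel_left`, `ψ_comp_ψ`, `pointsMap_comp_apply`, `pointsMap_zsmul_id`, `comp_hom_add'`, `Hom.mem_kerPoints_iff`.

References: [cite: Markman2025SecantWeil, §1.5 (p. 7) and §9.3 Lemma 9.3.3] [cite: vanGeemen1994HodgeAV, 4.9]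
[cite: GortzWedhorn2023, Prop. 27.178 (1) and (27.35.1)] [cite: MumfordAV1970, §7 Thm. 4 (p. 72)].
-/

noncomputable section

universe u

open CategoryTheory CategoryTheory.Limits AlgebraicGeometry

namespace Summit.HodgeConjecture.HodgeConjecture.Ring2.SemiregularRepresentatives

set_option linter.dupNamespace false -- the cell's namespace repeats the summit name, as in every `Ring2*` file

open Literature.AlgebraicGeometry Literature.AlgebraicGeometry.Motives Literature.AlgebraicGeometry.Motives.AbelianVariety
open Literature.AlgebraicGeometry.HodgeTheory Literature.AlgebraicGeometry.Markman2025

namespace SecantQuotientDatum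

variable (D : SecantQuotientDatum)

/-- `weilEndo 0 = φ_d`. [cite: Markman2025SecantWeil, §1.3] -/
theorem weilEndo_zero : D.weilEndo 0 = D.ψ := by
  rw [weilEndo_def, zero_smul, zero_add]

/-- **`φ_d` descends to the secant quotient**: there is `ψ̄ : Y → Y` with `q ≫ ψ̄ = φ_d ≫ q` (the mover of `u = 0 + φ_d`;
Markman §1.5 ∕ Lemma 9.3.3: `φ_d(Ḡ) = Ḡ`, so `φ_d` passes to `Y = (J × Ĵ)/Ḡ`). [cite: Markman2025SecantWeil, §1.5 (p. 7) and §9.3 Lemma 9.3.3] -/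
theorem exists_psiBar : ∃ ψbar : D.Y ⟶ D.Y, D.q ≫ ψbar = D.ψ ≫ D.q := by
  obtain ⟨g, hg⟩ := D.hasMover 0
  exact ⟨g, by rw [hg.q_comp, weilEndo_zero]⟩

variable {D}

/-- **Every mover is `m + ψ̄`**: if `q ≫ g = (m + φ_d) ≫ q` then `g = m • 𝟙_Y + ψ̄` (uniqueness of the descent along the
epimorphism `q`). [cite: Markman2025SecantWeil, §1.5 (p. 7)] [cite: GortzWedhorn2023, Prop. 27.178 (1)] -/
theorem IsMover.eq_zsmul_id_add_psiBar {ψbar : D.Y ⟶ D.Y} (h : D.q ≫ ψbar = D.ψ ≫ D.q) {m : ℤ} {g : D.Y ⟶ D.Y}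
    (hg : D.IsMover m g) : g = m • 𝟙 D.Y + ψbar := by
  apply D.isIsogeny_q.cancel_left
  rw [hg.q_comp, weilEndo_def, Preadditive.add_comp, Preadditive.comp_add, h, Preadditive.zsmul_comp, Preadditive.comp_zsmul,
    Category.id_comp, Category.comp_id]

/-- **`ψ̄(x) = x^{−m}` on a complex point `x` of `Ker ḡ_u`** (`ḡ_u = m + ψ̄` kills `x`: `x^m · ψ̄(x) = 1`).
[cite: Markman2025SecantWeil, §9.3 Lemma 9.3.3] [cite: GortzWedhorn2023, (27.35.1)] -/
theorem IsMover.pointsMap_psiBar_eq {ψbar : D.Y ⟶ D.Y} (h : D.q ≫ ψbar = D.ψ ≫ D.q) {m : ℤ} {g : D.Y ⟶ D.Y}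
    (hg : D.IsMover m g) {x : D.Y.Points ℂ} (hx : x ∈ Hom.kerPoints (specOver ℂ ℂ) g) :
    pointsMap ℂ ψbar x = (x ^ m)⁻¹ := by
  have hx1 : pointsMap ℂ g x = 1 := (Hom.mem_kerPoints_iff _ _).1 hx
  rw [hg.eq_zsmul_id_add_psiBar h, pointsMap_apply, AlgPoints.map_apply, comp_hom_add', comp_hom_zsmul] at hx1
  change (x ≫ 𝟙 _) ^ m * (x ≫ ψbar.hom.hom.hom) = 1 at hx1
  rw [Category.comp_id] at hx1
  rw [pointsMap_apply, AlgPoints.map_apply]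
  exact eq_inv_of_mul_eq_one_right hx1

/-- On complex points, `ψ̄(ψ̄(x)) = x^{−d}`. [cite: Markman2025SecantWeil, §9.3 Lemma 9.3.3] [cite: GortzWedhorn2023, (27.35.1)] -/
theorem pointsMap_psiBar_psiBar {ψbar : D.Y ⟶ D.Y} (h : D.q ≫ ψbar = D.ψ ≫ D.q) (x : D.Y.Points ℂ) :
    pointsMap ℂ ψbar (pointsMap ℂ ψbar x) = (x ^ (D.d : ℤ))⁻¹ := by
  rw [← pointsMap_comp_apply, D.psiBar_comp_psiBar' h, pointsMap_apply, AlgPoints.map_apply, comp_hom_neg, comp_hom_zsmul]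
  change ((x ≫ 𝟙 _) ^ (D.d : ℤ))⁻¹ = _
  rw [Category.comp_id]

/-- **`x^{m² + d} = 1` for every complex point `x` of the kernel of the mover `ḡ_u`, `u = m + φ_d`**: `ψ̄(x) = x^{−m}` twice gives
`x^{m²} = ψ̄(ψ̄(x)) = x^{−d}` (W9 §1: `Ker ḡ_u ⊆ Y[Nm u]`, `Nm u = m² + d`).
[cite: Markman2025SecantWeil, §9.3 Lemma 9.3.3] [cite: MumfordAV1970, §7 Thm. 4 (p. 72)] -/
theorem IsMover.zpow_sq_add_eq_one {m : ℤ} {g : D.Y ⟶ D.Y} (hg : D.IsMover m g) {x : D.Y.Points ℂ}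
    (hx : x ∈ Hom.kerPoints (specOver ℂ ℂ) g) : x ^ (m ^ 2 + (D.d : ℤ)) = 1 := by
  obtain ⟨ψbar, h⟩ := D.exists_psiBar
  have h1 : pointsMap ℂ ψbar x = (x ^ m)⁻¹ := hg.pointsMap_psiBar_eq h hx
  have h3 : pointsMap ℂ ψbar (pointsMap ℂ ψbar x) = x ^ (m * m) := by
    rw [h1, map_inv, map_zpow, h1, inv_zpow, inv_inv, ← zpow_mul]
  have h4 : x ^ (m * m) = (x ^ (D.d : ℤ))⁻¹ := h3.symm.trans (pointsMap_psiBar_psiBar h x)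
  rw [zpow_add, sq, h4, inv_mul_cancel]

/-- A complex point of a mover kernel has finite order. [cite: Markman2025SecantWeil, §9.3 Lemma 9.3.3] -/
theorem IsMover.isOfFinOrder_of_mem_kerPoints {m : ℤ} {g : D.Y ⟶ D.Y} (hg : D.IsMover m g) {x : D.Y.Points ℂ}
    (hx : x ∈ Hom.kerPoints (specOver ℂ ℂ) g) : IsOfFinOrder x := by
  have hpos : (m ^ 2 + (D.d : ℤ)) ≠ 0 := by
    have hd : (0 : ℤ) < (D.d : ℤ) := by exact_mod_cast lt_of_lt_of_le (by norm_num) D.four_le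
    positivity
  exact isOfFinOrder_iff_zpow_eq_one.2 ⟨m ^ 2 + (D.d : ℤ), hpos, hg.zpow_sq_add_eq_one hx⟩

/-- **The order of a complex point of `Ker ḡ_u` divides `m² + d`.** [cite: Markman2025SecantWeil, §9.3 Lemma 9.3.3] -/
theorem IsMover.orderOf_dvd_of_mem_kerPoints {m : ℤ} {g : D.Y ⟶ D.Y} (hg : D.IsMover m g) {x : D.Y.Points ℂ}
    (hx : x ∈ Hom.kerPoints (specOver ℂ ℂ) g) : (orderOf x : ℤ) ∣ m ^ 2 + (D.d : ℤ) :=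
  orderOf_dvd_iff_zpow_eq_one.2 (hg.zpow_sq_add_eq_one hx)

end SecantQuotientDatum

end Summit.HodgeConjecture.HodgeConjecture.Ring2.SemiregularRepresentatives

end
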